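import Summits.BirchSwinnertonDyer.BirchSwinnertonDyer.Theorems.SignedLowerHalvesSmallImageLowerHalfBothSignsRttCharRoadE1TorsionRestrict
import Summits.BirchSwinnertonDyer.BirchSwinnertonDyer.Theorems.SignedLowerHalvesSmallImageLowerHalfBothSignsRttCharRoadE1ThetaSideFacts
import HarnessLib

/-!
# Route `SignedLowerHalves`, crux L `SmallImageLowerHalfBothSigns` (stmt-BirchSwinnertonDyer-23599), line `rtt_w3` v12 — glue INPUT (I5) `hs_S` of `injTop_of_inputs`
# (p770240): PRELIMINARIES — rank-one action, `(π)` in `𝒪_S`, `π`-power torsion of `A_θ`, generic `hH0 ⇐ hT0`, scalars realising `τ ∈ Γ_K` on `W_K[p]`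

Width seat `bsd-line-slh-p3-w3` g18 under LEAD `cruxlead-stmt-BirchSwinnertonDyer-23599` (cell `bsd-ssimc`; `--supports stmt-BirchSwinnertonDyer-23599 --as helper`).
THEOREMS ONLY (no definition, no named fact, no instance, no `sorry`). Sequel: `…RttCharRoadE1GlobalEquivariance.lean` (the residual character identity and `hs_S`).
BSD / crux L / INJ_top are NOT proved here.

* `smul_eq_entry_smul` — on `Cofree θ F` of rank `1`, `g • m = θ(g)₀₀ • m`.
* `mem_span_singleton_of_norm_lt_one`, `isMaximal_span_singleton_of_irreducible` — in `𝒪_S`, `‖x‖ < 1 ⇒ x ∈ (π)`; `(π)` is maximal (`π` irreducible).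
* `exists_pow_smul_eq_zero_cofree` — `htors`: `A_θ` is `π`-power torsion.
* ★ `eq_zero_of_forall_smul_eq_of_coords` — GENERIC `hH0 ⇐ hT0`: no non-zero `H`-fixed point in `M` when the coordinates are `Γ`-equivariant and jointly
  injective on `M[π]` and `T^H = 0` (not consumed by `injTop_of_inputs`; recorded for inflation–restriction uses).
* ★ `exists_scalar_realising` — for every `τ ∈ Γ_K` a scalar `b` with `u_b = τ` on `W_K[p]` (rigidity p768789 on the restricted scalars p768916, with
  honda's non-scalar witness `hw`).

References: [Serre1972] §2.2; [SerreLocalFields1979] II §3; [Greenberg1989] §1.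
-/

set_option autoImplicit false
set_option linter.dupNamespace false -- D-0017: single-problem summit, the namespace repeats the problem name by design
noncomputable section

open scoped Classical MatrixGroups NumberField

namespace Summit.BirchSwinnertonDyer.BirchSwinnertonDyer.Theorems.SmallImageCharSignedSelmer

open NumberField IsDedekindDomain Field Literature.NumberTheory.GaloisRepresentations Literature.NumberTheory.GaloisRepresentations.Serre1972
  Literature.NumberTheory.EllipticCurves Literature.NumberTheory.EllipticCurves.GreenbergSelmer WeierstrassCurve Matrix

/-! ## §1 Rank one: the Galois action on `Cofree θ` is the scalar `θ(g)₀₀` -/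

section RankOne

variable {K : Type} [Field K] {p : ℕ} [Fact p.Prime] {S : Set (PadicAlgCl p)} (θ : FramedGaloisRep K (padicCoeffIntegers S) 1)

/-- On the rank-one cofree module `A_θ = F/𝒪`, `g • m = θ(g)₀₀ • m`. [folklore] -/
theorem smul_eq_entry_smul (g : absoluteGaloisGroup K) (m : Cofree θ (padicCoeffField S)) :
    g • m = (((θ g : GL (Fin 1) (padicCoeffIntegers S)) : Matrix (Fin 1) (Fin 1) (padicCoeffIntegers S)) 0 0) • m := by
  obtain ⟨x, rfl⟩ := cofreeMk_surjective (padicCoeffField S) θ m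
  rw [smul_cofreeMk, fracRepresentation_apply_apply, ← map_smul, ← algebraMap_smul (padicCoeffField S)]
  congr 1
  funext i
  rw [Matrix.mulVec, dotProduct, Fin.sum_univ_one, Pi.smul_apply, smul_eq_mul, Matrix.map_apply,
    Fin.fin_one_eq_zero i]

end RankOne

/-! ## §2 `𝒪_S`: elements of norm `< 1` lie in `(π)` -/

section Coeff

variable {p : ℕ} [Fact p.Prime] {S : Set (PadicAlgCl p)}

/-- In `𝒪_S`, an element of norm `< 1` is not a unit, hence lies in the maximal ideal `(π)` (`π` irreducible; `𝒪_S` a DVR). [cite: SerreLocalFields1979, II §3] -/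
theorem mem_span_singleton_of_norm_lt_one [FiniteDimensional ℚ_[p] (padicCoeffField S)] {π : padicCoeffIntegers S} (hπ : Irreducible π)
    {x : padicCoeffIntegers S} (hx : ‖(x : PadicAlgCl p)‖ < 1) : x ∈ Ideal.span {π} := by
  haveI : IsDiscreteValuationRing (padicCoeffIntegers S) := by
    rw [padicCoeffIntegers_eq_unitBall S]
    exact LambdaLowerBoundO.isDiscreteValuationRing_unitBall p (padicCoeffField S)
  rw [← (IsDiscreteValuationRing.irreducible_iff_uniformizer π).1 hπ]
  refine (IsLocalRing.mem_maximalIdeal _).2 fun hu ↦ ?_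
  obtain ⟨y, hy⟩ := hu.exists_right_inv
  have h1 : ‖((x * y : padicCoeffIntegers S) : PadicAlgCl p)‖ = 1 := by rw [hy]; exact norm_one
  rw [Subring.coe_mul, norm_mul] at h1
  have hy1 : ‖(y : PadicAlgCl p)‖ ≤ 1 := y.2.2
  nlinarith [norm_nonneg (y : PadicAlgCl p), norm_nonneg (x : PadicAlgCl p)]

/-- The ideal `(π)` of `𝒪_S` is maximal for an irreducible `π`. [cite: SerreLocalFields1979, II §3] -/
theorem isMaximal_span_singleton_of_irreducible [FiniteDimensional ℚ_[p] (padicCoeffField S)] {π : padicCoeffIntegers S} (hπ : Irreducible π) :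
    (Ideal.span {π}).IsMaximal := by
  haveI : IsDiscreteValuationRing (padicCoeffIntegers S) := by
    rw [padicCoeffIntegers_eq_unitBall S]
    exact LambdaLowerBoundO.isDiscreteValuationRing_unitBall p (padicCoeffField S)
  rw [← (IsDiscreteValuationRing.irreducible_iff_uniformizer π).1 hπ]
  exact IsLocalRing.maximalIdeal.isMaximal _

end Coeff

/-! ## §2b `A_θ` is `π`-power torsion; `H`-fixed points vanish when the coordinates see them (generic `hH0 ⇐ hT0`) -/

section Torsion

variable {K : Type} [Field K] {p : ℕ} [Fact p.Prime] {S : Set (PadicAlgCl p)} {n : ℕ} (θ : FramedGaloisRep K (padicCoeffIntegers S) n)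

/-- `htors`: every element of `A_θ = F_Sⁿ/𝒪_Sⁿ` is killed by a power of the irreducible `π` (`|π| < 1`, so `π^N x ∈ 𝒪_Sⁿ` for `N ≫ 0`).
[cite: Greenberg1989, §1 p. 98] -/
theorem exists_pow_smul_eq_zero_cofree {π : padicCoeffIntegers S} (hπ : Irreducible π) (m : Cofree θ (padicCoeffField S)) :
    ∃ N : ℕ, π ^ N • m = 0 := by
  obtain ⟨x, rfl⟩ := cofreeMk_surjective (padicCoeffField S) θ m
  have hπ1 : ‖(π : PadicAlgCl p)‖ < 1 := by
    rcases lt_or_eq_of_le π.2.2 with h | h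
    · exact h
    exfalso
    have hπ0 : (π : PadicAlgCl p) ≠ 0 := fun h0 ↦ by rw [h0, norm_zero] at h; exact zero_ne_one h
    exact hπ.not_isUnit ⟨⟨π, ⟨(π : PadicAlgCl p)⁻¹, inv_mem π.2.1, by rw [norm_inv, h, inv_one]⟩,
      Subtype.ext (mul_inv_cancel₀ hπ0), Subtype.ext (inv_mul_cancel₀ hπ0)⟩, rfl⟩
  set B : ℝ := ∑ i, ‖((x i : padicCoeffField S) : PadicAlgCl p)‖ with hB
  have hB0 : 0 ≤ B := Finset.sum_nonneg fun i _ ↦ norm_nonneg _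
  have hxB : ∀ i, ‖((x i : padicCoeffField S) : PadicAlgCl p)‖ ≤ B := fun i ↦
    Finset.single_le_sum (f := fun i ↦ ‖((x i : padicCoeffField S) : PadicAlgCl p)‖) (fun i _ ↦ norm_nonneg _) (Finset.mem_univ i)
  obtain ⟨N, hN⟩ := exists_pow_lt_of_lt_one (show 0 < 1 / (B + 1) by positivity) hπ1
  refine ⟨N, ?_⟩
  rw [← map_smul]
  refine LinearMap.mem_ker.1 ?_
  rw [ker_cofreeMk, mem_lattice_iff]
  have hmem : ∀ i, (π : PadicAlgCl p) ^ N * ((x i : padicCoeffField S) : PadicAlgCl p) ∈ padicCoeffIntegers S := fun i ↦ by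
    refine ⟨mul_mem (pow_mem π.2.1 N) (x i).2, ?_⟩
    rw [norm_mul, norm_pow]
    have h1 : ‖(π : PadicAlgCl p)‖ ^ N * ‖((x i : padicCoeffField S) : PadicAlgCl p)‖ ≤ 1 / (B + 1) * B :=
      mul_le_mul hN.le (hxB i) (norm_nonneg _) (by positivity)
    have h2 : 1 / (B + 1) * B ≤ 1 := by
      rw [div_mul_eq_mul_div, one_mul, div_le_one (by positivity)]
      linarith
    exact h1.trans h2
  refine ⟨fun i ↦ ⟨_, hmem i⟩, funext fun i ↦ Subtype.ext ?_⟩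
  change (π : PadicAlgCl p) ^ N * ((x i : padicCoeffField S) : PadicAlgCl p) = (((π ^ N • x) i : padicCoeffField S) : PadicAlgCl p)
  rw [Pi.smul_apply, Algebra.smul_def, IntermediateField.coe_mul]
  exact congrArg (· * _) (SubmonoidClass.coe_pow π N).symm

end Torsion

section FixedPoints

variable {Γ : Type*} [Group Γ] {M : Type*} [AddCommGroup M] [DistribMulAction Γ M] {R : Type*} [Ring R] [Module R M] [SMulCommClass Γ R M]
  {T : Type*} [AddCommGroup T] [DistribMulAction Γ T]

/-- ★ **`hH0` from `hT0` (generic).** If `M` is `π`-power torsion with an `R`-action commuting with `Γ`, the coordinates `s_l : M →+ T` are `Γ`-equivariant and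
jointly injective on `M[π]`, and `T` has no non-zero `H`-fixed point, then `M` has no non-zero `H`-fixed point (induction on the `π`-exponent: `π • m` is
`H`-fixed, and an `H`-fixed `m ∈ M[π]` has `H`-fixed, hence zero, coordinates). [folklore] -/
theorem eq_zero_of_forall_smul_eq_of_coords (H : Subgroup Γ) (π : R) (htors : ∀ m : M, ∃ N : ℕ, π ^ N • m = 0)
    (hT0 : ∀ t : T, (∀ x : H, (x : Γ) • t = t) → t = 0)
    {J : ℕ} (s : Fin J → (M →+ T)) (Sπ : AddSubgroup M) (hSπ : ∀ m : M, m ∈ Sπ ↔ π • m = 0)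
    (hsS : ∀ (l : Fin J) (g : Γ) (m : M), m ∈ Sπ → s l (g • m) = g • s l m)
    (hsinj : ∀ m : M, m ∈ Sπ → (∀ l : Fin J, s l m = 0) → m = 0)
    (m : M) (hm : ∀ x : H, (x : Γ) • m = m) : m = 0 := by
  obtain ⟨N, hN⟩ := htors m
  induction N generalizing m with
  | zero => rwa [pow_zero, one_smul] at hN
  | succ N ih =>
    have hπm : π • m = 0 := by
      refine ih (π • m) (fun x ↦ by rw [smul_comm, hm x]) ?_
      rwa [← mul_smul, ← pow_succ]
    have hmS : m ∈ Sπ := (hSπ m).2 hπm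
    exact hsinj m hmS fun l ↦ hT0 _ fun x ↦ by rw [← hsS l (x : Γ) m hmS, hm x]

end FixedPoints

/-! ## §3 Scalars realising `τ ∈ Γ_K` on `W_K[p]` -/

section Global

variable (W : WeierstrassCurve ℚ) {p : ℕ} [Fact p.Prime]
  (Φ : Multiplicative (AddAut (geomTorsion W p)) ≃* GL (Fin 2) (ZMod p))
  {k : Subalgebra (ZMod p) (Matrix (Fin 2) (Fin 2) (ZMod p))}
  (K : Type) [Field K] [NumberField K]

/-- **A scalar realising `τ ∈ Γ_K` on `W_K[p]`** exists for every `τ` (`ρ̄(res τ) ∈ kˣ` by `hKU`; rigidity p768789 applied to the restricted scalars p768916,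
with the non-scalar local element `δ₀` of `hw`). [cite: Serre1972, §2.2] -/
theorem exists_scalar_realising (h2k : Module.finrank (ZMod p) k = 2) (e₀ : geomTorsion W p ≃+ (Fin 2 → ZMod p))
    (he₀ : ∀ (g : Multiplicative (AddAut (geomTorsion W p))) (x : geomTorsion W p),
      e₀ (Multiplicative.toAdd g x) = ((Φ g : GL (Fin 2) (ZMod p)) : Matrix (Fin 2) (Fin 2) (ZMod p)) *ᵥ e₀ x)
    (hKU : ∀ τ : absoluteGaloisGroup K, Φ (galoisRepTorsion W p (absGaloisRestrict ℚ K τ)) ∈ Serre1972.unitGroup k)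
    {R : Type*} [CommRing R] (uK : R → ((W.baseChange K).geomPrimaryTorsion p →+ (W.baseChange K).geomPrimaryTorsion p))
    (hadd : ∀ (a b : R) (x : (W.baseChange K).geomPrimaryTorsion p), uK (a + b) x = uK a x + uK b x)
    (hmul : ∀ (a b : R) (x : (W.baseChange K).geomPrimaryTorsion p), uK (a * b) x = uK a (uK b x))
    (hone : ∀ x : (W.baseChange K).geomPrimaryTorsion p, uK 1 x = x)
    {E' : Type} [Field E'] [Algebra K E'] (ι : AlgebraicClosure K →ₐ[K] AlgebraicClosure E') (χLT : absoluteGaloisGroup E' → R)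
    (hχ : ∀ (δ : absoluteGaloisGroup E') (x : (W.baseChange K).geomPrimaryTorsion p), resGalOfEmb ι δ • x = uK (χLT δ) x)
    (hw : ∃ δ₀ : absoluteGaloisGroup E', ∀ n : ℕ, ∃ x : (W.baseChange K).geomPrimaryTorsion p, p • x = 0 ∧ uK (χLT δ₀) x ≠ n • x)
    (τ : absoluteGaloisGroup K) :
    ∃ b : R, ∀ x : (W.baseChange K).geomPrimaryTorsion p, p • x = 0 → uK b x = τ • x := by
  obtain ⟨u', hu', hadd', hmul', hone', -, hthrough, hwit⟩ := exists_torsionRestrict (W.baseChange K) p uK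
  obtain ⟨δ₀, hδ₀⟩ := hw
  set τ₀ : absoluteGaloisGroup K := resGalOfEmb ι δ₀ with hτ₀def
  have hτ₀act : ∀ Q : geomTorsion (W.baseChange K) p, τ₀ • Q = u' (χLT δ₀) Q := hthrough τ₀ (χLT δ₀) (fun x ↦ hχ δ₀ x)
  have hwit' : ∀ n : ℕ, ∃ Q : geomTorsion (W.baseChange K) p, u' (χLT δ₀) Q ≠ n • Q := fun n ↦ hwit (χLT δ₀) n (hδ₀ n)
  have hτ₀s : ∀ c : ZMod p,
      ((Φ (galoisRepTorsion W p (absGaloisRestrict ℚ K τ₀)) : GL (Fin 2) (ZMod p)) : Matrix (Fin 2) (Fin 2) (ZMod p)) ≠ c • 1 :=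
    coords_ne_smul_one_of_forall_exists_ne_nsmul ((torsionBaseChangeEquiv K W p).symm.trans e₀) (fun Q ↦ τ₀ • Q)
      (coords_smul_baseChange K W Φ e₀ he₀ τ₀) (fun n ↦ by
        obtain ⟨Q, hQ⟩ := hwit' n
        exact ⟨Q, by rw [hτ₀act]; exact hQ⟩)
  have hcomm : ∀ (r : R) (Q : geomTorsion (W.baseChange K) p), u' r (τ₀ • Q) = τ₀ • u' r Q := fun r Q ↦ by
    rw [hτ₀act, hτ₀act, ← hmul' hmul, mul_comm, hmul' hmul]
  have hr₀ : ∀ c : ZMod p, ∃ Q : geomTorsion (W.baseChange K) p,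
      ((torsionBaseChangeEquiv K W p).symm.trans e₀) (u' (χLT δ₀) Q) ≠ c • ((torsionBaseChangeEquiv K W p).symm.trans e₀) Q :=
    coords_ne_smul_of_ne_nsmul _ (u' (χLT δ₀)) hwit'
  obtain ⟨b, hb⟩ := forall_mem_exists_torsionAction_eq_baseChange K W Φ k e₀ he₀ h2k (hKU τ₀) hτ₀s u' (hadd' hadd) (hmul' hmul) (hone' hone)
    hcomm hr₀ (hKU τ)
  refine ⟨b, fun x hx ↦ ?_⟩
  -- `x` is `p`-torsion: `x = incl Q`
  have hxmem : (x : (W.baseChange K).geomPoints) ∈ geomTorsion (W.baseChange K) p := by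
    rw [mem_geomTorsion_iff, natCast_zsmul]
    change (((p • x : (W.baseChange K).geomPrimaryTorsion p)) : (W.baseChange K).geomPoints) = 0
    rw [hx]; rfl
  set Q : geomTorsion (W.baseChange K) p := ⟨(x : (W.baseChange K).geomPoints), hxmem⟩ with hQ
  have hxQ : AddSubgroup.inclusion (geomTorsion_le_geomPrimaryTorsion (W.baseChange K) p) Q = x := Subtype.ext rfl
  have huQ : u' b Q = τ • Q := ((torsionBaseChangeEquiv K W p).symm.trans e₀).injective (by
    rw [hb, coords_smul_baseChange K W Φ e₀ he₀ τ])
  rw [← hxQ, ← hu', huQ]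
  exact Subtype.ext rfl

end Global

end Summit.BirchSwinnertonDyer.BirchSwinnertonDyer.Theorems.SmallImageCharSignedSelmer

end
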